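import Summits.HodgeConjecture.HodgeConjecture.Theorems.Ring2WeilCoverageCMFieldCriteria
import HarnessLib

/-!
# Weil-type components over quartic CM fields with NO RATIONAL DISCRIMINANT, I: the norm-parity engine
# (the `ℓ`-adic valuation of `N_{E/ℚ}` is EVEN on `ℤ[η] ∖ 0` when every place of `F` over `ℓ` is inert in `E/F`)

research route conditional on HC_CM; not a corollary; Q11.4-sentence-2 already refuted in dim ≥ 3.
Cell `pub-hodge-ring2`, seat `ring2-b03` (gen 57); kernel certificates for the Weil-type family-coverage census
`HOME/WEIL-FAMILY-COVERAGE.md` §b03.5 (operator priority5 2026-08-22T11:46:08Z). The engines of gens 46–53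
(`Ring2WeilCoverageCMField{NormDescent, Criteria, InertPrimes, Ramified, DegreeOne*, AllPrimes*}`) decide the
classes `[n] ∈ F^×/Nm_{E/F}(E^×)` of RATIONAL integers `n` (`F = ℚ[S]/(R)`, `E = ℚ[T]/(R(T²))`,
`R = S² + pS + q`, Deligne's carriers `Deligne1982/WeilTypeCMDiscriminant`). The components `W8.E.δ` are indexed
by ALL totally positive classes `δ ∈ F^×/Nm_{E/F}(E^×)` (even sets `T` of non-split places), and for a GALOIS
quartic CM field most of them contain no rational number at all (§b03.5: «classes whose `T` contains exactly
one of two conjugate places have NO rational representative» — 11 to 13 of the 15 rows `|T| = 2` inside `S6`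
for each of the six Galois census fields; until now a computation, PARI ×2). This file is the elementary ENGINE
that puts that sentence in the kernel (the certificate on the carriers and the census instances are in the
companions `Ring2WeilCoverageCMFieldIrrationalRows.lean` / `…IrrationalRowsBiquadratic.lean`):

* **norm parity.** Let `ℓ` be a prime and `t₁, t₂ ∈ ℤ` with `t₁ + t₂ ≡ -p`, `t₁t₂ ≡ q (mod ℓ)` (the roots of
  `R` mod `ℓ`, equal or not), both NON-SQUARES mod `ℓ`, and `ℓ² ∤ R(tᵢ)` — i.e. `ℓ` splits (or ramifies
  regularly) in `F` and EVERY place of `F` over `ℓ` is INERT in `E = F(√σ)`, so every prime of `E` over `ℓ` has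
  residue degree `2`. Then the integer quartic form `G = N_{F/ℚ}(x² - σy²) = X² - pXY + qY²` (`X`, `Y` the
  coordinate forms of `NormDescent.normForm_coords`; `G(Z) = N_{E/ℚ}(Z)` for `Z = x + yη ∈ ℤ[η]`) never takes
  a value `ℓ^{odd}·(unit at ℓ)`: `c·G(Z) ≠ ℓ^{2n+1}·w` for `ℓ ∤ c, w` (`normParity_core`), hence
  `N²·G(Z) ≠ ℓ^{2n+1}·w·M²` (`normParity_sq`). PROOF: if `ℓ ∣ G(Z) ≡ (X + Yt₁)(X + Yt₂)` then at one root
  `X + Ytᵢ ≡ (a + btᵢ)² - tᵢ(c + dtᵢ)² ≡ 0`, and since `tᵢ` is a non-square, `x ≡ y ≡ 0` at that place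
  (`vanish_of_dvd_normFormNorm`); multiplying `Z` by `θ = σ - tⱼ` (the OTHER root; `N_{F/ℚ} θ = R(tⱼ) = ℓ·r`,
  `ℓ ∤ r`) makes all four coordinates divisible by `ℓ` (`exists_coords_mul_theta_div`), and `Z' = Zθ/ℓ` has
  `ℓ⁴·G(Z') = R(tⱼ)²·G(Z)` (`normFormNorm_step`, multiplicativity of the norm as a polynomial identity), so the
  `ℓ`-adic valuation of `G` drops by exactly `2` (`normParity_descent`): descent on `n`. All substitutions are
  explicit polynomial identities (`ring` / `linear_combination`); no valuation theory or ideal theory is imported.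

No named fact, no definition, no `sorry`; nothing about the Hodge conjecture is asserted.
References: [Deligne1982HodgeCycles] §4 p. 30 (1), Cor. 4.2, Lemma 4.6; [Landherr1936HermitianForms];
J. Neukirch, Algebraic Number Theory, III (1.7) / V (3.4) (`v_ℓ ∘ N_{E/ℚ}` is even when all residue degrees
over `ℓ` are even — here in elementary form). -/

noncomputable section

set_option linter.dupNamespace false

open Polynomial

namespace Summit.HodgeConjecture.HodgeConjecture.Ring2.WeilCoverageCM

open Literature.AlgebraicGeometry.Deligne1982
open Literature.AlgebraicGeometry.HodgeTheory (splitDiscriminantClassCM)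

/-! ### §1 The norm-parity engine -/

section Engine

variable (p q : ℤ) (ℓ : ℕ) [hℓ : Fact ℓ.Prime]

/-- **Vanishing at one place from an isotropic vector mod a root.** Over `𝔽_ℓ`, if `k` is a root of
`S² + pS + q` which is a NON-SQUARE and the coordinate forms satisfy `X + Y·k = 0` — i.e.
`(a + bk)² = k·(c + dk)²` — then `a + bk = 0` and `c + dk = 0` (the place `σ ↦ k` of `F` is inert in
`E = F(√σ)`: the binary form `x² - k y²` is anisotropic). [folklore] -/
theorem coords_vanish_of_root (k a b c d : ZMod ℓ) (hk : k ^ 2 + (p : ZMod ℓ) * k + (q : ZMod ℓ) = 0)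
    (hq : ∀ r : ZMod ℓ, r ^ 2 ≠ k)
    (h : (a ^ 2 - (q : ZMod ℓ) * b ^ 2 + 2 * (q : ZMod ℓ) * c * d - (p : ZMod ℓ) * (q : ZMod ℓ) * d ^ 2)
        + (2 * a * b - (p : ZMod ℓ) * b ^ 2 - c ^ 2 + 2 * (p : ZMod ℓ) * c * d
            - ((p : ZMod ℓ) ^ 2 - (q : ZMod ℓ)) * d ^ 2) * k = 0) :
    a + b * k = 0 ∧ c + d * k = 0 := by
  have h' : (a + b * k) ^ 2 = k * (c + d * k) ^ 2 := by
    linear_combination h + (b ^ 2 - 2 * c * d - d ^ 2 * (k - (p : ZMod ℓ))) * hk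
  by_cases hcd : c + d * k = 0
  · rw [hcd] at h'
    have h0 : (a + b * k) ^ 2 = 0 := by simpa using h'
    exact ⟨pow_eq_zero_iff (n := 2) (by norm_num) |>.1 h0, hcd⟩
  · exfalso
    refine hq ((a + b * k) / (c + d * k)) ?_
    rw [div_pow, div_eq_iff (pow_ne_zero 2 hcd)]
    linear_combination h'

/-- **`ℓ ∣ G(Z)` forces `x ≡ y ≡ 0` at ONE of the two places over `ℓ`.** With `t₁ + t₂ ≡ -p`, `t₁t₂ ≡ q`
(so `G = X² - pXY + qY² ≡ (X + Yt₁)(X + Yt₂) mod ℓ`) and both `tᵢ` non-squares mod `ℓ`: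
`ℓ ∣ G(A,B,C,D)` gives `ℓ ∣ A + tᵢB, C + tᵢD` for `i = 1` or `i = 2`. [folklore] -/
theorem vanish_of_dvd_normFormNorm (t₁ t₂ : ℤ) (hsum : (ℓ : ℤ) ∣ t₁ + t₂ + p) (hprod : (ℓ : ℤ) ∣ t₁ * t₂ - q)
    (hq₁ : ∀ r : ZMod ℓ, r ^ 2 ≠ (t₁ : ZMod ℓ)) (hq₂ : ∀ r : ZMod ℓ, r ^ 2 ≠ (t₂ : ZMod ℓ)) (A B C D : ℤ)
    (h : (ℓ : ℤ) ∣ (A ^ 2 - q * B ^ 2 + 2 * q * C * D - p * q * D ^ 2) ^ 2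
        - p * (A ^ 2 - q * B ^ 2 + 2 * q * C * D - p * q * D ^ 2)
            * (2 * A * B - p * B ^ 2 - C ^ 2 + 2 * p * C * D - (p ^ 2 - q) * D ^ 2)
        + q * (2 * A * B - p * B ^ 2 - C ^ 2 + 2 * p * C * D - (p ^ 2 - q) * D ^ 2) ^ 2) :
    ((ℓ : ℤ) ∣ A + t₁ * B ∧ (ℓ : ℤ) ∣ C + t₁ * D) ∨ ((ℓ : ℤ) ∣ A + t₂ * B ∧ (ℓ : ℤ) ∣ C + t₂ * D) := by
  have hs : (t₁ : ZMod ℓ) + (t₂ : ZMod ℓ) + (p : ZMod ℓ) = 0 := by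
    have := (ZMod.intCast_zmod_eq_zero_iff_dvd _ ℓ).2 hsum; push_cast at this; exact this
  have hpq : (t₁ : ZMod ℓ) * (t₂ : ZMod ℓ) - (q : ZMod ℓ) = 0 := by
    have := (ZMod.intCast_zmod_eq_zero_iff_dvd _ ℓ).2 hprod; push_cast at this; exact this
  have hk₁ : (t₁ : ZMod ℓ) ^ 2 + (p : ZMod ℓ) * (t₁ : ZMod ℓ) + (q : ZMod ℓ) = 0 := by
    linear_combination (t₁ : ZMod ℓ) * hs - hpq
  have hk₂ : (t₂ : ZMod ℓ) ^ 2 + (p : ZMod ℓ) * (t₂ : ZMod ℓ) + (q : ZMod ℓ) = 0 := by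
    linear_combination (t₂ : ZMod ℓ) * hs - hpq
  set a : ZMod ℓ := (A : ZMod ℓ) with ha
  set b : ZMod ℓ := (B : ZMod ℓ) with hb
  set c : ZMod ℓ := (C : ZMod ℓ) with hc
  set d : ZMod ℓ := (D : ZMod ℓ) with hd
  set x : ZMod ℓ := a ^ 2 - (q : ZMod ℓ) * b ^ 2 + 2 * (q : ZMod ℓ) * c * d - (p : ZMod ℓ) * (q : ZMod ℓ) * d ^ 2
    with hx
  set y : ZMod ℓ := 2 * a * b - (p : ZMod ℓ) * b ^ 2 - c ^ 2 + 2 * (p : ZMod ℓ) * c * d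
    - ((p : ZMod ℓ) ^ 2 - (q : ZMod ℓ)) * d ^ 2 with hy
  have hG : x ^ 2 - (p : ZMod ℓ) * x * y + (q : ZMod ℓ) * y ^ 2 = 0 := by
    have := (ZMod.intCast_zmod_eq_zero_iff_dvd _ ℓ).2 h; push_cast at this
    rw [hx, hy, ha, hb, hc, hd]
    linear_combination this
  have hfac : (x + y * (t₁ : ZMod ℓ)) * (x + y * (t₂ : ZMod ℓ)) = 0 := by
    linear_combination hG + (x * y) * hs + y ^ 2 * hpq
  -- back to `ℤ`
  have back : ∀ (t : ℤ) (U V : ℤ), (U : ZMod ℓ) + (V : ZMod ℓ) * (t : ZMod ℓ) = 0 → (ℓ : ℤ) ∣ U + t * V := by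
    intro t U V hUV
    refine (ZMod.intCast_zmod_eq_zero_iff_dvd _ ℓ).1 ?_
    push_cast
    linear_combination hUV
  rcases mul_eq_zero.1 hfac with h1 | h2
  · obtain ⟨hab, hcd⟩ := coords_vanish_of_root p q ℓ (t₁ : ZMod ℓ) a b c d hk₁ hq₁ (by rw [hx, hy] at h1; exact h1)
    exact Or.inl ⟨back t₁ A B hab, back t₁ C D hcd⟩
  · obtain ⟨hab, hcd⟩ := coords_vanish_of_root p q ℓ (t₂ : ZMod ℓ) a b c d hk₂ hq₂ (by rw [hx, hy] at h2; exact h2)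
    exact Or.inr ⟨back t₂ A B hab, back t₂ C D hcd⟩

omit hℓ in
/-- **Multiplication by `θ = σ - t'` makes the coordinates divisible by `ℓ`.** If `x = A + Bσ ≡ 0` at the
place `σ ↦ t` (`ℓ ∣ A + tB`) and `t'` is the other root (`t + t' ≡ -p`, `tt' ≡ q`), then
`xθ = (-At' - qB) + (A - (p + t')B)σ` has both coordinates divisible by `ℓ` (`θ ≡ 0` at the place `σ ↦ t'`,
`x ≡ 0` at the place `σ ↦ t`, and `ℤ[σ]/ℓ` sees both places). [folklore] -/
theorem exists_coords_mul_theta_div (t t' : ℤ) (hsum : (ℓ : ℤ) ∣ t + t' + p) (hprod : (ℓ : ℤ) ∣ t * t' - q)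
    (A B : ℤ) (hA : (ℓ : ℤ) ∣ A + t * B) :
    ∃ A' B' : ℤ, (ℓ : ℤ) * A' = -(A * t') - q * B ∧ (ℓ : ℤ) * B' = A - (p + t') * B := by
  obtain ⟨g, hg⟩ := hA
  obtain ⟨s, hs⟩ := hsum
  obtain ⟨r, hr⟩ := hprod
  refine ⟨-(g * t') + B * r, g - B * s, ?_, ?_⟩
  · linear_combination t' * hg - B * hr
  · linear_combination -hg + B * hs

/-- **The norm drops by `R(t')²/ℓ⁴` under `Z ↦ Zθ/ℓ`** (`θ = σ - t'`, `N_{F/ℚ} θ = R(t') = t'² + pt' + q`):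
if `ℓ·(A', B', C', D')` are the coordinates of `(x + yη)·θ`, then
`ℓ⁴·G(A',B',C',D') = R(t')²·G(A,B,C,D)` — multiplicativity of `N_{E/ℚ}`, as a polynomial identity. [folklore] -/
theorem normFormNorm_step (t' A B C D A' B' C' D' : ℤ) (L : ℤ)
    (h1 : L * A' = -(A * t') - q * B) (h2 : L * B' = A - (p + t') * B)
    (h3 : L * C' = -(C * t') - q * D) (h4 : L * D' = C - (p + t') * D) :
    L ^ 4 * ((A' ^ 2 - q * B' ^ 2 + 2 * q * C' * D' - p * q * D' ^ 2) ^ 2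
        - p * (A' ^ 2 - q * B' ^ 2 + 2 * q * C' * D' - p * q * D' ^ 2)
            * (2 * A' * B' - p * B' ^ 2 - C' ^ 2 + 2 * p * C' * D' - (p ^ 2 - q) * D' ^ 2)
        + q * (2 * A' * B' - p * B' ^ 2 - C' ^ 2 + 2 * p * C' * D' - (p ^ 2 - q) * D' ^ 2) ^ 2)
      = (t' ^ 2 + p * t' + q) ^ 2 * ((A ^ 2 - q * B ^ 2 + 2 * q * C * D - p * q * D ^ 2) ^ 2
        - p * (A ^ 2 - q * B ^ 2 + 2 * q * C * D - p * q * D ^ 2)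
            * (2 * A * B - p * B ^ 2 - C ^ 2 + 2 * p * C * D - (p ^ 2 - q) * D ^ 2)
        + q * (2 * A * B - p * B ^ 2 - C ^ 2 + 2 * p * C * D - (p ^ 2 - q) * D ^ 2) ^ 2) := by
  -- stage 1: homogeneity, `L⁴·G(A',…) = G(LA',…)`; stage 2: the coordinates of `Zθ` are `θ²·(X + Yσ)` with
  -- `θ² = (t'² - q) + (-p - 2t')σ`; stage 3: `N_{F/ℚ}` is multiplicative and `N_{F/ℚ}(θ²) = R(t')²`.
  set X₀ := A ^ 2 - q * B ^ 2 + 2 * q * C * D - p * q * D ^ 2 with hX₀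
  set Y₀ := 2 * A * B - p * B ^ 2 - C ^ 2 + 2 * p * C * D - (p ^ 2 - q) * D ^ 2 with hY₀
  have eX : (L * A') ^ 2 - q * (L * B') ^ 2 + 2 * q * (L * C') * (L * D') - p * q * (L * D') ^ 2
      = (t' ^ 2 - q) * X₀ + q * (p + 2 * t') * Y₀ := by
    rw [h1, h2, h3, h4, hX₀, hY₀]; ring
  have eY : 2 * (L * A') * (L * B') - p * (L * B') ^ 2 - (L * C') ^ 2 + 2 * p * (L * C') * (L * D')
        - (p ^ 2 - q) * (L * D') ^ 2
      = (t' ^ 2 - q) * Y₀ - (p + 2 * t') * X₀ + p * (p + 2 * t') * Y₀ := by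
    rw [h1, h2, h3, h4, hX₀, hY₀]; ring
  have hom : L ^ 4 * ((A' ^ 2 - q * B' ^ 2 + 2 * q * C' * D' - p * q * D' ^ 2) ^ 2
        - p * (A' ^ 2 - q * B' ^ 2 + 2 * q * C' * D' - p * q * D' ^ 2)
            * (2 * A' * B' - p * B' ^ 2 - C' ^ 2 + 2 * p * C' * D' - (p ^ 2 - q) * D' ^ 2)
        + q * (2 * A' * B' - p * B' ^ 2 - C' ^ 2 + 2 * p * C' * D' - (p ^ 2 - q) * D' ^ 2) ^ 2)
      = ((L * A') ^ 2 - q * (L * B') ^ 2 + 2 * q * (L * C') * (L * D') - p * q * (L * D') ^ 2) ^ 2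
        - p * ((L * A') ^ 2 - q * (L * B') ^ 2 + 2 * q * (L * C') * (L * D') - p * q * (L * D') ^ 2)
            * (2 * (L * A') * (L * B') - p * (L * B') ^ 2 - (L * C') ^ 2 + 2 * p * (L * C') * (L * D')
                - (p ^ 2 - q) * (L * D') ^ 2)
        + q * (2 * (L * A') * (L * B') - p * (L * B') ^ 2 - (L * C') ^ 2 + 2 * p * (L * C') * (L * D')
            - (p ^ 2 - q) * (L * D') ^ 2) ^ 2 := by
    ring
  rw [hom, eX, eY]
  ring

omit hℓ in
/-- `R(t') = t'(t + t' + p) - (tt' - q)` is divisible by `ℓ`. [folklore] -/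
theorem dvd_R_of_roots (t t' : ℤ) (hsum : (ℓ : ℤ) ∣ t + t' + p) (hprod : (ℓ : ℤ) ∣ t * t' - q) :
    (ℓ : ℤ) ∣ t' ^ 2 + p * t' + q := by
  have e : t' ^ 2 + p * t' + q = t' * (t + t' + p) - (t * t' - q) := by ring
  rw [e]
  exact dvd_sub (dvd_mul_of_dvd_right hsum _) hprod

/-- **One descent step.** From `c·G(Z) = ℓ^{2n+1}·w` with `ℓ ∤ c` produce `Z'` and `r` with `ℓ ∤ r` and
`c·ℓ·G(Z') = ℓ^{2n}·(w·r²)` (`Z' = Zθ/ℓ`, `R(t') = ℓr`). [folklore] -/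
theorem normParity_descent (t₁ t₂ : ℤ) (hsum : (ℓ : ℤ) ∣ t₁ + t₂ + p) (hprod : (ℓ : ℤ) ∣ t₁ * t₂ - q)
    (hq₁ : ∀ r : ZMod ℓ, r ^ 2 ≠ (t₁ : ZMod ℓ)) (hq₂ : ∀ r : ZMod ℓ, r ^ 2 ≠ (t₂ : ZMod ℓ))
    (hR₁ : ¬ (ℓ : ℤ) ^ 2 ∣ t₁ ^ 2 + p * t₁ + q) (hR₂ : ¬ (ℓ : ℤ) ^ 2 ∣ t₂ ^ 2 + p * t₂ + q)
    (n : ℕ) (A B C D c w : ℤ) (hc : ¬ (ℓ : ℤ) ∣ c)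
    (h : c * ((A ^ 2 - q * B ^ 2 + 2 * q * C * D - p * q * D ^ 2) ^ 2
        - p * (A ^ 2 - q * B ^ 2 + 2 * q * C * D - p * q * D ^ 2)
            * (2 * A * B - p * B ^ 2 - C ^ 2 + 2 * p * C * D - (p ^ 2 - q) * D ^ 2)
        + q * (2 * A * B - p * B ^ 2 - C ^ 2 + 2 * p * C * D - (p ^ 2 - q) * D ^ 2) ^ 2)
      = (ℓ : ℤ) ^ (2 * n + 1) * w) :
    ∃ A' B' C' D' r : ℤ, ¬ (ℓ : ℤ) ∣ r ∧
      c * ((ℓ : ℤ) * ((A' ^ 2 - q * B' ^ 2 + 2 * q * C' * D' - p * q * D' ^ 2) ^ 2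
        - p * (A' ^ 2 - q * B' ^ 2 + 2 * q * C' * D' - p * q * D' ^ 2)
            * (2 * A' * B' - p * B' ^ 2 - C' ^ 2 + 2 * p * C' * D' - (p ^ 2 - q) * D' ^ 2)
        + q * (2 * A' * B' - p * B' ^ 2 - C' ^ 2 + 2 * p * C' * D' - (p ^ 2 - q) * D' ^ 2) ^ 2))
      = (ℓ : ℤ) ^ (2 * n) * (w * r ^ 2) := by
  have hℓp : Prime (ℓ : ℤ) := Nat.prime_iff_prime_int.1 hℓ.out
  have hℓ0 : (ℓ : ℤ) ≠ 0 := hℓp.ne_zero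
  set G₀ := (A ^ 2 - q * B ^ 2 + 2 * q * C * D - p * q * D ^ 2) ^ 2
        - p * (A ^ 2 - q * B ^ 2 + 2 * q * C * D - p * q * D ^ 2)
            * (2 * A * B - p * B ^ 2 - C ^ 2 + 2 * p * C * D - (p ^ 2 - q) * D ^ 2)
        + q * (2 * A * B - p * B ^ 2 - C ^ 2 + 2 * p * C * D - (p ^ 2 - q) * D ^ 2) ^ 2 with hG₀
  -- `ℓ ∣ G(Z)`
  have hℓG : (ℓ : ℤ) ∣ G₀ := by
    have h1 : (ℓ : ℤ) ∣ c * G₀ := ⟨(ℓ : ℤ) ^ (2 * n) * w, by rw [h]; ring⟩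
    exact (hℓp.dvd_or_dvd h1).resolve_left hc
  -- the generic step at a root `t` where the coordinates vanish, `t'` the other root
  have step : ∀ t t' : ℤ, (ℓ : ℤ) ∣ t + t' + p → (ℓ : ℤ) ∣ t * t' - q → ¬ (ℓ : ℤ) ^ 2 ∣ t' ^ 2 + p * t' + q →
      (ℓ : ℤ) ∣ A + t * B → (ℓ : ℤ) ∣ C + t * D →
      ∃ A' B' C' D' r : ℤ, ¬ (ℓ : ℤ) ∣ r ∧
        c * ((ℓ : ℤ) * ((A' ^ 2 - q * B' ^ 2 + 2 * q * C' * D' - p * q * D' ^ 2) ^ 2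
          - p * (A' ^ 2 - q * B' ^ 2 + 2 * q * C' * D' - p * q * D' ^ 2)
              * (2 * A' * B' - p * B' ^ 2 - C' ^ 2 + 2 * p * C' * D' - (p ^ 2 - q) * D' ^ 2)
          + q * (2 * A' * B' - p * B' ^ 2 - C' ^ 2 + 2 * p * C' * D' - (p ^ 2 - q) * D' ^ 2) ^ 2))
        = (ℓ : ℤ) ^ (2 * n) * (w * r ^ 2) := by
    intro t t' hs hp hR' hA hC
    obtain ⟨A', B', h1, h2⟩ := exists_coords_mul_theta_div p q ℓ t t' hs hp A B hA
    obtain ⟨C', D', h3, h4⟩ := exists_coords_mul_theta_div p q ℓ t t' hs hp C D hC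
    obtain ⟨r, hr⟩ := dvd_R_of_roots p q ℓ t t' hs hp
    have hrℓ : ¬ (ℓ : ℤ) ∣ r := by
      rintro ⟨r', rfl⟩
      exact hR' ⟨r', by rw [hr]; ring⟩
    have key := normFormNorm_step p q t' A B C D A' B' C' D' (ℓ : ℤ) h1 h2 h3 h4
    rw [← hG₀, hr] at key
    refine ⟨A', B', C', D', r, hrℓ, ?_⟩
    -- `ℓ³ · (c ℓ G(Z')) = ℓ³ · (ℓ^{2n} w r²)`
    have e3 : (ℓ : ℤ) ^ 3 * (c * ((ℓ : ℤ) * ((A' ^ 2 - q * B' ^ 2 + 2 * q * C' * D' - p * q * D' ^ 2) ^ 2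
          - p * (A' ^ 2 - q * B' ^ 2 + 2 * q * C' * D' - p * q * D' ^ 2)
              * (2 * A' * B' - p * B' ^ 2 - C' ^ 2 + 2 * p * C' * D' - (p ^ 2 - q) * D' ^ 2)
          + q * (2 * A' * B' - p * B' ^ 2 - C' ^ 2 + 2 * p * C' * D' - (p ^ 2 - q) * D' ^ 2) ^ 2)))
        = (ℓ : ℤ) ^ 3 * ((ℓ : ℤ) ^ (2 * n) * (w * r ^ 2)) := by
      have e4 : (ℓ : ℤ) ^ 3 * ((ℓ : ℤ) ^ (2 * n) * (w * r ^ 2)) = r ^ 2 * (ℓ : ℤ) ^ 2 * ((ℓ : ℤ) ^ (2 * n + 1) * w) := by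
        ring
      rw [e4, ← h]
      linear_combination c * key
    exact mul_left_cancel₀ (pow_ne_zero 3 hℓ0) e3
  rcases vanish_of_dvd_normFormNorm p q ℓ t₁ t₂ hsum hprod hq₁ hq₂ A B C D (by rw [← hG₀]; exact hℓG) with
    ⟨hA, hC⟩ | ⟨hA, hC⟩
  · exact step t₁ t₂ hsum hprod hR₂ hA hC
  · exact step t₂ t₁ (by rw [add_comm t₂ t₁]; exact hsum) (by rw [mul_comm t₂ t₁]; exact hprod) hR₁ hA hC

/-- **NORM PARITY (core).** Under the hypotheses of §1 (`t₁ + t₂ ≡ -p`, `t₁t₂ ≡ q (mod ℓ)`, both `tᵢ`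
non-squares mod `ℓ`, `ℓ² ∤ R(tᵢ)`): `c·G(A,B,C,D) ≠ ℓ^{2n+1}·w` whenever `ℓ ∤ c` and `ℓ ∤ w` — the `ℓ`-adic
valuation of `N_{E/ℚ}` is EVEN on `ℤ[η] ∖ 0`. [cite: Deligne1982HodgeCycles, §4 p. 30 (1)]
[cite: Landherr1936HermitianForms] -/
theorem normParity_core (t₁ t₂ : ℤ) (hsum : (ℓ : ℤ) ∣ t₁ + t₂ + p) (hprod : (ℓ : ℤ) ∣ t₁ * t₂ - q)
    (hq₁ : ∀ r : ZMod ℓ, r ^ 2 ≠ (t₁ : ZMod ℓ)) (hq₂ : ∀ r : ZMod ℓ, r ^ 2 ≠ (t₂ : ZMod ℓ))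
    (hR₁ : ¬ (ℓ : ℤ) ^ 2 ∣ t₁ ^ 2 + p * t₁ + q) (hR₂ : ¬ (ℓ : ℤ) ^ 2 ∣ t₂ ^ 2 + p * t₂ + q) :
    ∀ (n : ℕ) (A B C D c w : ℤ), ¬ (ℓ : ℤ) ∣ c → ¬ (ℓ : ℤ) ∣ w →
      c * ((A ^ 2 - q * B ^ 2 + 2 * q * C * D - p * q * D ^ 2) ^ 2
        - p * (A ^ 2 - q * B ^ 2 + 2 * q * C * D - p * q * D ^ 2)
            * (2 * A * B - p * B ^ 2 - C ^ 2 + 2 * p * C * D - (p ^ 2 - q) * D ^ 2)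
        + q * (2 * A * B - p * B ^ 2 - C ^ 2 + 2 * p * C * D - (p ^ 2 - q) * D ^ 2) ^ 2)
      ≠ (ℓ : ℤ) ^ (2 * n + 1) * w := by
  have hℓp : Prime (ℓ : ℤ) := Nat.prime_iff_prime_int.1 hℓ.out
  have hℓ0 : (ℓ : ℤ) ≠ 0 := hℓp.ne_zero
  intro n
  induction n with
  | zero =>
    intro A B C D c w hc hw h
    obtain ⟨A', B', C', D', r, hr, h'⟩ :=
      normParity_descent p q ℓ t₁ t₂ hsum hprod hq₁ hq₂ hR₁ hR₂ 0 A B C D c w hc h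
    rw [mul_zero, pow_zero, one_mul] at h'
    have hdvd : (ℓ : ℤ) ∣ w * r ^ 2 := by
      rw [← h']; exact dvd_mul_of_dvd_right (dvd_mul_right _ _) _
    rcases hℓp.dvd_or_dvd hdvd with h1 | h1
    · exact hw h1
    · exact hr (hℓp.dvd_of_dvd_pow h1)
  | succ m ih =>
    intro A B C D c w hc hw h
    obtain ⟨A', B', C', D', r, hr, h'⟩ :=
      normParity_descent p q ℓ t₁ t₂ hsum hprod hq₁ hq₂ hR₁ hR₂ (m + 1) A B C D c w hc h
    have hw' : ¬ (ℓ : ℤ) ∣ w * r ^ 2 := by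
      intro hdvd
      rcases hℓp.dvd_or_dvd hdvd with h1 | h1
      · exact hw h1
      · exact hr (hℓp.dvd_of_dvd_pow h1)
    refine ih A' B' C' D' c (w * r ^ 2) hc hw' (mul_left_cancel₀ hℓ0 ?_)
    have e : (ℓ : ℤ) ^ (2 * (m + 1)) * (w * r ^ 2) = (ℓ : ℤ) * ((ℓ : ℤ) ^ (2 * m + 1) * (w * r ^ 2)) := by ring
    rw [← e, ← h']
    ring

/-- **NORM PARITY with square factors**: `N²·G(A,B,C,D) ≠ ℓ^{2n+1}·w·M²` for `N, M ≠ 0`, `ℓ ∤ w` (peel the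
powers of `ℓ` off `N` and `M`, then `normParity_core` with `c = N²`, `w ↦ wM²`). [folklore] -/
theorem normParity_sq (t₁ t₂ : ℤ) (hsum : (ℓ : ℤ) ∣ t₁ + t₂ + p) (hprod : (ℓ : ℤ) ∣ t₁ * t₂ - q)
    (hq₁ : ∀ r : ZMod ℓ, r ^ 2 ≠ (t₁ : ZMod ℓ)) (hq₂ : ∀ r : ZMod ℓ, r ^ 2 ≠ (t₂ : ZMod ℓ))
    (hR₁ : ¬ (ℓ : ℤ) ^ 2 ∣ t₁ ^ 2 + p * t₁ + q) (hR₂ : ¬ (ℓ : ℤ) ^ 2 ∣ t₂ ^ 2 + p * t₂ + q) :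
    ∀ (k : ℕ) (n : ℕ) (N M A B C D w : ℤ), N.natAbs + M.natAbs ≤ k → N ≠ 0 → M ≠ 0 → ¬ (ℓ : ℤ) ∣ w →
      N ^ 2 * ((A ^ 2 - q * B ^ 2 + 2 * q * C * D - p * q * D ^ 2) ^ 2
        - p * (A ^ 2 - q * B ^ 2 + 2 * q * C * D - p * q * D ^ 2)
            * (2 * A * B - p * B ^ 2 - C ^ 2 + 2 * p * C * D - (p ^ 2 - q) * D ^ 2)
        + q * (2 * A * B - p * B ^ 2 - C ^ 2 + 2 * p * C * D - (p ^ 2 - q) * D ^ 2) ^ 2)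
      ≠ (ℓ : ℤ) ^ (2 * n + 1) * w * M ^ 2 := by
  have hℓp : Prime (ℓ : ℤ) := Nat.prime_iff_prime_int.1 hℓ.out
  have hℓ0 : (ℓ : ℤ) ≠ 0 := hℓp.ne_zero
  have hℓ2 : 2 ≤ ℓ := hℓ.out.two_le
  -- `|N₁| < |ℓ N₁|` for `N₁ ≠ 0`
  have shrink : ∀ N₁ : ℤ, N₁ ≠ 0 → N₁.natAbs < ((ℓ : ℤ) * N₁).natAbs := by
    intro N₁ hN₁
    rw [Int.natAbs_mul, Int.natAbs_natCast]
    have : 0 < N₁.natAbs := Int.natAbs_pos.2 hN₁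
    nlinarith
  set G := fun A B C D : ℤ => (A ^ 2 - q * B ^ 2 + 2 * q * C * D - p * q * D ^ 2) ^ 2
        - p * (A ^ 2 - q * B ^ 2 + 2 * q * C * D - p * q * D ^ 2)
            * (2 * A * B - p * B ^ 2 - C ^ 2 + 2 * p * C * D - (p ^ 2 - q) * D ^ 2)
        + q * (2 * A * B - p * B ^ 2 - C ^ 2 + 2 * p * C * D - (p ^ 2 - q) * D ^ 2) ^ 2 with hGdef
  intro k
  induction k with
  | zero =>
    intro n N M A B C D w hk hN _ _ _
    have : N.natAbs = 0 := by omega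
    exact hN (Int.natAbs_eq_zero.1 this)
  | succ k ih =>
    intro n N M A B C D w hk hN hM hw h
    change N ^ 2 * G A B C D = (ℓ : ℤ) ^ (2 * n + 1) * w * M ^ 2 at h
    by_cases hℓN : (ℓ : ℤ) ∣ N
    · obtain ⟨N₁, rfl⟩ := hℓN
      have hN₁ : N₁ ≠ 0 := by rintro rfl; exact hN (mul_zero _)
      have hltN := shrink N₁ hN₁
      cases n with
      | zero =>
        -- `ℓ² N₁² G = ℓ w M²` ⇒ `ℓ ∣ M`, `M = ℓ M₁`, `N₁² G = ℓ w M₁²`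
        have h1 : (ℓ : ℤ) * (N₁ ^ 2 * G A B C D) = w * M ^ 2 := by
          refine mul_left_cancel₀ hℓ0 ?_
          rw [mul_zero, zero_add, pow_one] at h
          linear_combination h
        have hℓM : (ℓ : ℤ) ∣ M := by
          have hd : (ℓ : ℤ) ∣ w * M ^ 2 := ⟨_, h1.symm⟩
          rcases hℓp.dvd_or_dvd hd with h2 | h2
          · exact absurd h2 hw
          · exact hℓp.dvd_of_dvd_pow h2
        obtain ⟨M₁, rfl⟩ := hℓM
        have hM₁ : M₁ ≠ 0 := by rintro rfl; exact hM (mul_zero _)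
        have hltM := shrink M₁ hM₁
        refine ih 0 N₁ M₁ A B C D w (by omega) hN₁ hM₁ hw ?_
        change N₁ ^ 2 * G A B C D = (ℓ : ℤ) ^ (2 * 0 + 1) * w * M₁ ^ 2
        refine mul_left_cancel₀ hℓ0 ?_
        rw [h1]
        ring
      | succ m =>
        refine ih m N₁ M A B C D w (by omega) hN₁ hM hw ?_
        change N₁ ^ 2 * G A B C D = (ℓ : ℤ) ^ (2 * m + 1) * w * M ^ 2
        refine mul_left_cancel₀ (pow_ne_zero 2 hℓ0) ?_
        have e : (ℓ : ℤ) ^ 2 * ((ℓ : ℤ) ^ (2 * m + 1) * w * M ^ 2) = (ℓ : ℤ) ^ (2 * (m + 1) + 1) * w * M ^ 2 := by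
          ring
        rw [e, ← h]
        ring
    · by_cases hℓM : (ℓ : ℤ) ∣ M
      · obtain ⟨M₁, rfl⟩ := hℓM
        have hM₁ : M₁ ≠ 0 := by rintro rfl; exact hM (mul_zero _)
        have hltM := shrink M₁ hM₁
        refine ih (n + 1) N M₁ A B C D w (by omega) hN hM₁ hw ?_
        change N ^ 2 * G A B C D = (ℓ : ℤ) ^ (2 * (n + 1) + 1) * w * M₁ ^ 2
        rw [h]
        ring
      · have hc : ¬ (ℓ : ℤ) ∣ N ^ 2 := fun hd => hℓN (hℓp.dvd_of_dvd_pow hd)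
        have hw' : ¬ (ℓ : ℤ) ∣ w * M ^ 2 := by
          intro hd
          rcases hℓp.dvd_or_dvd hd with h2 | h2
          · exact hw h2
          · exact hℓM (hℓp.dvd_of_dvd_pow h2)
        exact normParity_core p q ℓ t₁ t₂ hsum hprod hq₁ hq₂ hR₁ hR₂ n A B C D (N ^ 2) (w * M ^ 2) hc hw'
          (by change N ^ 2 * G A B C D = _; rw [h]; ring)

end Engine

end Summit.HodgeConjecture.HodgeConjecture.Ring2.WeilCoverageCM

end
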